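import Summits.QuantumFields.BalabanUV.Beta.FP.RelInvPeriodisedEffFormCoarse
import Summits.QuantumFields.BalabanUV.Beta.FP.NestedStepLawOneShotLetters

/-!
# `BalabanUV.Beta.FP.CoarseJetUnit` — road «FP» (binder row D1), ROUTE T, the (T-INV) ∕ (T-ID) junction at ORDER 0:
# THE UNIT `(wVH (j+1))⁻¹` DROPS OUT OF THE COARSE SLICED 2-JET; THE TORUS CALL's COARSE TERM READS AS THE LEVEL-`(j+1)` SLICED
# ONE-STEP 2-JET GIVEN THE DICTIONARY AT ORDERS 1–2

HONEST DEPENDENCY (page 1, mandatory): continuum YM on T⁴ ⇐ BetaPertH ∧ nine spine estimates (0/9 proved); BetaPertH ⇐ (D1) ∧ (D4) ∧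
CAP+tail; G-an2-4 gates asym, D1 and NE2/3/4.  HONEST FRAMING (cell contract, verbatim): «discharging `BetaPertH` makes Bałaban's UV
stability UNCONDITIONAL — a real constructive-QFT result; it is NOT the continuum limit and NOT the Clay problem.»  ABSOLUTE RULE (cell
charter, verbatim): «No internally-minted statement may enter as a cited fact. Every hypothesis is either kernel-proved in this package or a
verbatim quotation of a PUBLISHED theorem with page reference. The manuscript(s) under audit are NOT citable for their own disputed steps — they
are the thing under adjudication; programme-internal (2001/route/tribunal) claims are never citable.»  THIS MODULE is [folklore] finite-dimensional
bookkeeping BY NAME over `RelInvPeriodisedCoarse.kkt_smul_form_mul` (p313296), `NestedStepLawOneShotLetters.secondVar_mul_right` (p311351) and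
`RelInvPeriodisedEffFormCoarse.hId_order_zero_record` ∕ `wVH_pos` (p315453).  No `Prop`, no `def`, nothing cited, 0 sorry.  «not in print; our bookkeeping».

WHY.  The torus call of route T (`NestedStepLawTorusInstance.secondVar_oneShot_nestedStepLaw_torus`, p313662, and its δ-constrained form
`NestedStepLawTorusInstanceDelta.secondVar_oneShot_nestedStepLaw_torus_delta`, p316503 — OWNER d1-p3) concludes «one-shot sliced 2-jet = fine level-`j` one-step sliced 2-jet + COARSE sliced 2-jet + FP defect», the coarse term being
`secondVar (kkt S.toBlocks₁₁ [Q₂₀;τ₂]) (kkt E₁ [Q₂₁;0]) (kkt E₂ [Q₂₂;0])` with `S = effForm H₀ [Q₁₀;τ₁]` and `E₁ E₂` the effective-form jet words.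
`RelInvPeriodisedEffFormCoarse.hId_order_zero(_record)` identified `S.toBlocks₁₁ = (wVH d Lc (j+1))⁻¹ • H'₀` with `H'₀` the periodised level-`(j+1)`
field block.  The dictionary (Q-FP-16-5, orders 1–2, an2) is to identify `E₁ E₂` with `(wVH d Lc (j+1))⁻¹ • H'₁`, `(wVH d Lc (j+1))⁻¹ • H'₂` for the
level-`(j+1)` insertion tables `H'₁ H'₂`.  This file supplies the order-0 word that then makes the coarse term LITERALLY the level-`(j+1)` sliced one-step
2-jet: a non-zero scalar on the FORM block of a bordered 2-jet does not change its `secondVar` (`log|det kkt (c•H(u)) Q(u)| = log|det kkt H(u) Q(u)| + const`).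

CONTENT.
* §1 `kkt_smul_form_eq_conj` (`kkt (c•H) Q = diag(c•1, 1) · kkt H Q · diag(1, c⁻¹•1)`, `c ≠ 0`), `secondVar_mul_left` (a STATIC invertible left factor drops
  out of `secondVar`; left twin of the OWNER's `secondVar_mul_right`).
* §2 **`secondVar_kkt_smul_form`**: `secondVar (kkt (c•H₀) Q₀) (kkt (c•H₁) Q₁) (kkt (c•H₂) Q₂) = secondVar (kkt H₀ Q₀) (kkt H₁ Q₁) (kkt H₂ Q₂)` for `c ≠ 0`
  and ANY `Hᵢ Qᵢ` (no symmetry, no invertibility) — the jet-level twin of p313296's `det_kkt_smul_form`.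
* §3 **`secondVar_coarse_of_hId`**: in the exact shape of the torus call's coarse term — `E₀ = c • H'₀`, `E₁ = c • H'₁`, `E₂ = c • H'₂`, `c ≠ 0` ⇒
  `secondVar (kkt E₀ [Q₂₀;τ₂]) (kkt E₁ [Q₂₁;0]) (kkt E₂ [Q₂₂;0]) = secondVar (kkt H'₀ [Q₂₀;τ₂]) (kkt H'₁ [Q₂₁;0]) (kkt H'₂ [Q₂₂;0])`.
* §4 **`torus_coarse_secondVar_of_hId`**: AT THE RECORD (p313662's `hH₀ hQ₁₀ hτ₁ hS` verbatim, coarse multipliers `(p̄, κ) ↦ (cp p̄, inr κ)`, `cp p̄ = Lc • p̄`):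
  `hId₀` DISCHARGED by `hId_order_zero_record` (`c := (wVH d Lc (j+1))⁻¹ ≠ 0`), `hId₁ hId₂` DISPLAYED ⇒ the coarse term equals
  `secondVar (kkt H'₀ [Q₂₀;τ₂]) (kkt H'₁ [Q₂₁;0]) (kkt H'₂ [Q₂₂;0])` with `H'₀ := (perF M′ (bhKStepAt d (toSite r′) Lc (j+1)))∘(fields, fields)` — THE TORUS
  CALL's OWN `hH₀` ONE LEVEL UP (`(M′, r′, j+1)` for `(fine Lc M′, r, j)`): the self-similar reading that telescopes the finite-`j` law, modulo exactly the
  two displayed identifications (`hId₁ hId₂` stay DISPLAYED VERBATIM — they are the row-D1 owner an2's rows; junction with p316503 certified by the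
  unit's `CERT-concat-Delta-CoarseJetUnit-LevelUp.lean`: `rw [← torus_coarse_secondVar_of_hId …]; exact secondVar_oneShot_nestedStepLaw_torus_delta …`).
WHAT IT IS NOT: NOT orders 1–2 of the dictionary (`hId₁ hId₂` are hypotheses: the level-`j` insertion tables pushed through the effective-form jet words
`= (wVH (j+1))⁻¹ •` the level-`(j+1)` insertion tables — an2's Q-FP-16-5 proper); NOT (T-ID), NOT SDF, NOT D1, NOT BetaPertH, NOT continuum, NOT Clay;
discharges NO binder of row D1 by itself; 0 estimates.  Unit `b2b-balaban-beta-d1-formalise-leaf-05` (gen 26), 2026-08-22.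
-/

noncomputable section

open scoped BigOperators Matrix

namespace Summit.QuantumFields.BalabanUV.Beta.FP.CoarseJetUnit

open Matrix
open Literature.Probability.LatticeModels (Torus.proj)
open Literature.MathematicalPhysics.QuantumFieldTheory.Balaban1983to89
open Literature.MathematicalPhysics.QuantumFieldTheory.Balaban1983to89.Beta
open Literature.MathematicalPhysics.QuantumFieldTheory.Balaban1983to89.Beta.Composition (kkt)
open Literature.MathematicalPhysics.QuantumFieldTheory.Balaban1983to89.Beta.CompositionSingular (effForm)
open B5Prop11Plancherel (fine)
open B6Lemma24Torus (pbox)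
open AffineAveraging (Site box toSite)
open OneStepResolventKernel (Fib)
open BalabanStepJetsSucc (wVH)
open Summit.QuantumFields.BalabanUV.Beta.BorderedHessian (bhKStepAt)
open Summit.QuantumFields.BalabanUV.Beta.D1BFx.LogDetSecondVariation (secondVar)
open Summit.QuantumFields.BalabanUV.Beta.FP.KernelPeriodisationFib (Idx perF)
open Summit.QuantumFields.BalabanUV.Beta.FP.TorusCombRows (Res combRowsT)
open Summit.QuantumFields.BalabanUV.Beta.FP.RelInvPeriodisedCoarse (kkt_smul_form_mul)
open Summit.QuantumFields.BalabanUV.Beta.FP.RelInvPeriodisedEffFormCoarse (hId_order_zero_record wVH_pos)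
open Summit.QuantumFields.BalabanUV.Beta.FP.NestedStepLawOneShotLetters (secondVar_mul_right)

/-! ## §1 Scaling the form block is a static two-sided conjugation; static invertible factors drop out of `secondVar` -/

section Generic

variable {ι ν κ μ ρ₂ : Type*} [Fintype ι] [Fintype ν] [Fintype κ] [Fintype μ] [Fintype ρ₂]
  [DecidableEq ι] [DecidableEq ν] [DecidableEq κ] [DecidableEq μ] [DecidableEq ρ₂]

omit [Fintype ι] [Fintype μ] [Fintype ρ₂] [DecidableEq ι] [DecidableEq μ] [DecidableEq ρ₂] in
/-- [folklore] **SCALING THE FORM BLOCK IS A STATIC CONJUGATION**: for `c ≠ 0`,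
`kkt (c•H) Q = diag(c•1, 1) · kkt H Q · diag(1, c⁻¹•1)` (p313296's `kkt_smul_form_mul`, the right factor inverted). -/
theorem kkt_smul_form_eq_conj {c : ℝ} (hc : c ≠ 0) (H : Matrix ν ν ℝ) (Q : Matrix κ ν ℝ) :
    kkt (c • H) Q
      = fromBlocks (c • (1 : Matrix ν ν ℝ)) 0 0 (1 : Matrix κ κ ℝ) * kkt H Q
          * fromBlocks (1 : Matrix ν ν ℝ) 0 0 (c⁻¹ • (1 : Matrix κ κ ℝ)) := by
  have hDD : fromBlocks (1 : Matrix ν ν ℝ) 0 0 (c • (1 : Matrix κ κ ℝ)) * fromBlocks (1 : Matrix ν ν ℝ) 0 0 (c⁻¹ • (1 : Matrix κ κ ℝ))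
      = 1 := by
    rw [fromBlocks_multiply]
    simp only [Matrix.mul_one, Matrix.mul_zero, add_zero, zero_add, Matrix.mul_smul, smul_zero, smul_smul, inv_mul_cancel₀ hc,
      one_smul, fromBlocks_one]
  calc kkt (c • H) Q
      = kkt (c • H) Q * (fromBlocks (1 : Matrix ν ν ℝ) 0 0 (c • (1 : Matrix κ κ ℝ))
          * fromBlocks (1 : Matrix ν ν ℝ) 0 0 (c⁻¹ • (1 : Matrix κ κ ℝ))) := by rw [hDD, Matrix.mul_one]
    _ = kkt (c • H) Q * fromBlocks (1 : Matrix ν ν ℝ) 0 0 (c • (1 : Matrix κ κ ℝ))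
          * fromBlocks (1 : Matrix ν ν ℝ) 0 0 (c⁻¹ • (1 : Matrix κ κ ℝ)) := by rw [Matrix.mul_assoc]
    _ = fromBlocks (c • (1 : Matrix ν ν ℝ)) 0 0 (1 : Matrix κ κ ℝ) * kkt H Q
          * fromBlocks (1 : Matrix ν ν ℝ) 0 0 (c⁻¹ • (1 : Matrix κ κ ℝ)) := by rw [kkt_smul_form_mul]

omit [Fintype ν] [Fintype κ] [Fintype μ] [Fintype ρ₂] [DecidableEq ν] [DecidableEq κ] [DecidableEq μ] [DecidableEq ρ₂] in
/-- [folklore] **`secondVar` IS INVARIANT UNDER A STATIC INVERTIBLE LEFT FACTOR**: `secondVar (C·A₀) (C·A₁) (C·A₂) = secondVar A₀ A₁ A₂`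
(`log|det(C·A(u))| = log|det A(u)| + const`; left twin of `NestedStepLawOneShotLetters.secondVar_mul_right`). -/
theorem secondVar_mul_left (C A₀ A₁ A₂ : Matrix ι ι ℝ) (hC : IsUnit C.det) :
    secondVar (C * A₀) (C * A₁) (C * A₂) = secondVar A₀ A₁ A₂ := by
  have hCC : C⁻¹ * C = 1 := Matrix.nonsing_inv_mul C hC
  have e : ∀ X : Matrix ι ι ℝ, (C * A₀)⁻¹ * (C * X) = A₀⁻¹ * X := fun X => by
    rw [Matrix.mul_inv_rev, Matrix.mul_assoc, ← Matrix.mul_assoc C⁻¹ C X, hCC, Matrix.one_mul]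
  unfold secondVar
  rw [e A₂, e A₁]

/-! ## §2 The unit drops out of a bordered 2-jet -/

omit [Fintype ι] [Fintype μ] [Fintype ρ₂] [DecidableEq ι] [DecidableEq μ] [DecidableEq ρ₂] in
/-- [folklore] **A NON-ZERO SCALAR ON THE FORM BLOCK DROPS OUT OF THE BORDERED 2-JET**: for `c ≠ 0` and ANY `H₀ H₁ H₂`, `Q₀ Q₁ Q₂`
(no symmetry, no invertibility asked),
`secondVar (kkt (c•H₀) Q₀) (kkt (c•H₁) Q₁) (kkt (c•H₂) Q₂) = secondVar (kkt H₀ Q₀) (kkt H₁ Q₁) (kkt H₂ Q₂)` —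
the jet-level twin of `RelInvPeriodisedCoarse.det_kkt_smul_form` (`det kkt (c•H) Q · c^{#κ} = c^{#ν} · det kkt H Q`). -/
theorem secondVar_kkt_smul_form {c : ℝ} (hc : c ≠ 0) (H₀ H₁ H₂ : Matrix ν ν ℝ) (Q₀ Q₁ Q₂ : Matrix κ ν ℝ) :
    secondVar (kkt (c • H₀) Q₀) (kkt (c • H₁) Q₁) (kkt (c • H₂) Q₂) = secondVar (kkt H₀ Q₀) (kkt H₁ Q₁) (kkt H₂ Q₂) := by
  have hL : IsUnit (fromBlocks (c • (1 : Matrix ν ν ℝ)) 0 0 (1 : Matrix κ κ ℝ)).det := by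
    rw [det_fromBlocks_zero₂₁, det_one, mul_one, det_smul, det_one, mul_one]
    exact isUnit_iff_ne_zero.2 (pow_ne_zero _ hc)
  have hR : IsUnit (fromBlocks (1 : Matrix ν ν ℝ) 0 0 (c⁻¹ • (1 : Matrix κ κ ℝ))).det := by
    rw [det_fromBlocks_zero₂₁, det_one, one_mul, det_smul, det_one, mul_one]
    exact isUnit_iff_ne_zero.2 (pow_ne_zero _ (inv_ne_zero hc))
  rw [kkt_smul_form_eq_conj hc H₀, kkt_smul_form_eq_conj hc H₁, kkt_smul_form_eq_conj hc H₂,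
    secondVar_mul_right _ _ _ _ hR, secondVar_mul_left _ _ _ _ hL]

/-! ## §3 The coarse term of the one-shot-sliced composite step law, in its exact shape -/

omit [Fintype ι] [Fintype ν] [DecidableEq ι] [DecidableEq ν] in
/-- [folklore] **THE COARSE SLICED 2-JET UNDER THE IDENTIFICATIONS `hId₀ hId₁ hId₂`** (the exact shape of the coarse term of
`NestedStepLawOneShotJets.secondVar_oneShot_nestedStepLaw_jets(_of_uni)` ∕ the torus call, with `E₀ := S.toBlocks₁₁`, `E₁ E₂ :=` the effective-form
jet words' `toBlocks₁₁`): if `Eᵢ = c • H'ᵢ` (`i = 0, 1, 2`) for one non-zero scalar `c`, then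
`secondVar (kkt E₀ [Q₂₀;τ₂]) (kkt E₁ [Q₂₁;0]) (kkt E₂ [Q₂₂;0]) = secondVar (kkt H'₀ [Q₂₀;τ₂]) (kkt H'₁ [Q₂₁;0]) (kkt H'₂ [Q₂₂;0])`. -/
theorem secondVar_coarse_of_hId {c : ℝ} (hc : c ≠ 0) {E₀ E₁ E₂ H'₀ H'₁ H'₂ : Matrix μ μ ℝ}
    (Q₂₀ Q₂₁ Q₂₂ : Matrix κ μ ℝ) (τ₂ : Matrix ρ₂ μ ℝ)
    (hId₀ : E₀ = c • H'₀) (hId₁ : E₁ = c • H'₁) (hId₂ : E₂ = c • H'₂) :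
    secondVar (kkt E₀ (fromRows Q₂₀ τ₂)) (kkt E₁ (fromRows Q₂₁ (0 : Matrix ρ₂ μ ℝ))) (kkt E₂ (fromRows Q₂₂ (0 : Matrix ρ₂ μ ℝ)))
      = secondVar (kkt H'₀ (fromRows Q₂₀ τ₂)) (kkt H'₁ (fromRows Q₂₁ (0 : Matrix ρ₂ μ ℝ))) (kkt H'₂ (fromRows Q₂₂ (0 : Matrix ρ₂ μ ℝ))) := by
  rw [hId₀, hId₁, hId₂]
  exact secondVar_kkt_smul_form hc _ _ _ _ _ _

end Generic

/-! ## §4 At the record: the torus call's coarse term is the level-`(j+1)` sliced one-step 2-jet, given the dictionary at orders 1–2 -/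

section Record

variable {d : ℕ} {Lc : ℕ} [NeZero Lc] {r : Fin (d + 1) → ℕ} (M' : Fin (d + 1) → ℕ) [∀ i, NeZero (M' i)]

set_option synthInstance.maxSize 1024 in
/-- **[folklore] THE TORUS CALL's COARSE TERM READ ONE LEVEL UP.**  At the index types of record (`NestedStepLawTorusInstance` p313662 ∕ `…Delta`:
fine box `fine Lc M′` at level `j`, root `r ∈ box (d+1) Lc`; `H₀ Q₁₀ τ₁` by the call's defining equations with the coarse multipliers presented by
`(p̄, κ) ↦ (cp p̄, inr κ)`, `cp p̄ = Lc • p̄`, letters `hfμ hcoarse`; `S = effForm H₀ [Q₁₀;τ₁]`), for ANY coarse border `Q₂₀ Q₂₁ Q₂₂`, ANY coarse slice `τ₂`,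
ANY coarse root `r′`, and ANY `E₁ E₂ H'₁ H'₂` satisfying the dictionary's orders 1–2
`hId₁ : E₁ = (wVH d Lc (j+1))⁻¹ • H'₁`, `hId₂ : E₂ = (wVH d Lc (j+1))⁻¹ • H'₂` (DISPLAYED):
`secondVar (kkt S.toBlocks₁₁ [Q₂₀;τ₂]) (kkt E₁ [Q₂₁;0]) (kkt E₂ [Q₂₂;0]) = secondVar (kkt H'₀ [Q₂₀;τ₂]) (kkt H'₁ [Q₂₁;0]) (kkt H'₂ [Q₂₂;0])`
with `H'₀ := (perF M′ (bhKStepAt d (toSite r′) Lc (j+1)))∘(fields, fields)` — the torus call's own `hH₀` at `(M′, r′, j+1)`.  Order 0 (`hId₀`) is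
`RelInvPeriodisedEffFormCoarse.hId_order_zero_record`; the unit is removed by `secondVar_coarse_of_hId`. -/
theorem torus_coarse_secondVar_of_hId (hr : r ∈ box (d + 1) Lc) (j : ℕ) (r' : Fin (d + 1) → ℕ)
    (cp : ↥(pbox M') → ↥(pbox (fine Lc M'))) (hcp : ∀ p : ↥(pbox M'), (cp p : Site (d + 1)) = (Lc : ℤ) • (p : Site (d + 1)))
    (hfμ : Function.Injective (fun a : ↥(pbox M') × Fin (d + 1) => ((cp a.1, Sum.inr a.2) : Idx (fine Lc M') (Fib d))))
    (hcoarse : ∀ (s : ↥(pbox (fine Lc M'))) (m : Fin (d + 1)),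
      ((s, Sum.inr m) : Idx (fine Lc M') (Fib d)) ∈ Set.range (fun a : ↥(pbox M') × Fin (d + 1) => ((cp a.1, Sum.inr a.2) : Idx (fine Lc M') (Fib d)))
        ↔ Torus.proj Lc (s : Site (d + 1)) = 0)
    -- the fine objects of the torus call, by defining equations (p313662 verbatim)
    {H₀ : Matrix (↥(pbox (fine Lc M')) × Fin (d + 1)) (↥(pbox (fine Lc M')) × Fin (d + 1)) ℝ}
    {Q₁₀ : Matrix (↥(pbox M') × Fin (d + 1)) (↥(pbox (fine Lc M')) × Fin (d + 1)) ℝ}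
    {τ₁ : Matrix (Res (toSite r) Lc (fine Lc M')) (↥(pbox (fine Lc M')) × Fin (d + 1)) ℝ}
    (hH₀ : H₀ = (perF (fine Lc M') (bhKStepAt d (toSite r) Lc j)).submatrix
        (fun b : ↥(pbox (fine Lc M')) × Fin (d + 1) => ((b.1, Sum.inl b.2) : Idx (fine Lc M') (Fib d)))
        (fun b : ↥(pbox (fine Lc M')) × Fin (d + 1) => ((b.1, Sum.inl b.2) : Idx (fine Lc M') (Fib d))))
    (hQ₁₀ : Q₁₀ = (perF (fine Lc M') (bhKStepAt d (toSite r) Lc j)).submatrix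
        (fun a : ↥(pbox M') × Fin (d + 1) => ((cp a.1, Sum.inr a.2) : Idx (fine Lc M') (Fib d)))
        (fun b : ↥(pbox (fine Lc M')) × Fin (d + 1) => ((b.1, Sum.inl b.2) : Idx (fine Lc M') (Fib d))))
    (hτ₁ : τ₁ = (combRowsT (toSite r) Lc (fine Lc M')).submatrix id
        (fun b : ↥(pbox (fine Lc M')) × Fin (d + 1) => ((b.1, Sum.inl b.2) : Idx (fine Lc M') (Fib d))))
    {S : Matrix ((↥(pbox M') × Fin (d + 1)) ⊕ Res (toSite r) Lc (fine Lc M')) ((↥(pbox M') × Fin (d + 1)) ⊕ Res (toSite r) Lc (fine Lc M')) ℝ}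
    (hS : effForm H₀ (fromRows Q₁₀ τ₁) = S)
    -- the coarse border and slice of the torus call (free here)
    {κ ρ₂ : Type*} [Fintype κ] [DecidableEq κ] [Fintype ρ₂] [DecidableEq ρ₂]
    (Q₂₀ Q₂₁ Q₂₂ : Matrix κ (↥(pbox M') × Fin (d + 1)) ℝ) (τ₂ : Matrix ρ₂ (↥(pbox M') × Fin (d + 1)) ℝ)
    -- the dictionary at orders 1–2, DISPLAYED
    {E₁ E₂ H'₁ H'₂ : Matrix (↥(pbox M') × Fin (d + 1)) (↥(pbox M') × Fin (d + 1)) ℝ}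
    (hId₁ : E₁ = (wVH d Lc (j + 1))⁻¹ • H'₁) (hId₂ : E₂ = (wVH d Lc (j + 1))⁻¹ • H'₂) :
    secondVar (kkt S.toBlocks₁₁ (fromRows Q₂₀ τ₂)) (kkt E₁ (fromRows Q₂₁ (0 : Matrix ρ₂ (↥(pbox M') × Fin (d + 1)) ℝ)))
        (kkt E₂ (fromRows Q₂₂ (0 : Matrix ρ₂ (↥(pbox M') × Fin (d + 1)) ℝ)))
      = secondVar
          (kkt ((perF M' (bhKStepAt d (toSite r') Lc (j + 1))).submatrix
              (fun b : ↥(pbox M') × Fin (d + 1) => ((b.1, Sum.inl b.2) : Idx M' (Fib d)))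
              (fun b : ↥(pbox M') × Fin (d + 1) => ((b.1, Sum.inl b.2) : Idx M' (Fib d))))
            (fromRows Q₂₀ τ₂))
          (kkt H'₁ (fromRows Q₂₁ (0 : Matrix ρ₂ (↥(pbox M') × Fin (d + 1)) ℝ)))
          (kkt H'₂ (fromRows Q₂₂ (0 : Matrix ρ₂ (↥(pbox M') × Fin (d + 1)) ℝ))) := by
  have hw : (wVH d Lc (j + 1))⁻¹ ≠ 0 := inv_ne_zero (wVH_pos (d := d) (Nat.pos_of_ne_zero (NeZero.ne Lc)) (j + 1)).ne'
  have hId₀ := hId_order_zero_record M' hr j r' cp hcp hfμ hcoarse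
  rw [← hS, hH₀, hQ₁₀, hτ₁]
  exact secondVar_coarse_of_hId hw Q₂₀ Q₂₁ Q₂₂ τ₂ hId₀ hId₁ hId₂

end Record

end Summit.QuantumFields.BalabanUV.Beta.FP.CoarseJetUnit

end
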